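import Literature.Computability.Complexity.AverageCaseDepthHierarchyAsymA
import Literature.Computability.Complexity.AverageCaseDepthHierarchyFinal
import HarnessLib

/-!
# RST Theorem 1: the error budget and the discharge of `rossmanServedioTan2015_thm1_inRegime`

B. Rossman, R. A. Servedio, L.-Y. Tan, *An average-case depth hierarchy theorem for Boolean
circuits*, arXiv:1504.03398 [RossmanServedioTan2015], Theorem 1 (p. 3) via §11.2 (pp. 37–38):
"`bias(…) ≤ δ + Σ` failure probabilities, all `o(1)`; taking `s = w^{1/5}`, size `S ≤ 2^{n^{1/(6(d-1))}}`
… the claimed `n^{-Ω(1/d)}` bound".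

With `s = ⌈w^{1/5}⌉`, `E = ⌊w^{4/5}⌋`, `ε₀ = 4 t₁ (Δ₀ + 1)`, this file bounds every term of
`errTot` for `m ≥ m₀` in the regime (`budget`: `errTot ≤ 2^{-m/24} ≤ n^{-1/(48 d)}`), and concludes
`rossmanServedioTan2015_thm1_inRegime_holds` with `c = min(c_{7.1}, c_{w₀}, 1/64)`, `C = 1/48` from
`agreement_le`, `regimeFacts_of`, `typFacts_of`, `bias_window` and the landed discharges of
Lemma 7.1 and of `w₀ = 2^m ln 2 (1 ± o(1))`. The second range hypothesis of the fact
(`d ≤ c √(log n)/log log n`) is not needed.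
-/

noncomputable section

namespace Literature.Computability.Complexity

namespace RSTProj

open Finset Real

section Budget

variable {m d : ℕ}

/-- `2^x ≤ e^x` for `x ≥ 0`. [folklore] -/
theorem two_rpow_le_exp {x : ℝ} (hx : 0 ≤ x) : (2 : ℝ) ^ x ≤ Real.exp x := by
  rw [Real.rpow_def_of_pos two_pos, Real.exp_le_exp]
  have := Real.log_two_lt_d9
  nlinarith

/-- `s = ⌈w^{1/5}⌉` satisfies `w^{1/5} ≤ s ≤ 2 m 2^{m/5}`, `1 ≤ s`, `8m ≤ s`. [cite: RossmanServedioTan2015, §11.2 (p. 38, `s = w^{1/5}`)] -/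
theorem s_bounds (hm : 128 ≤ m) (hS : Small m) :
    (rstW m : ℝ) ^ ((1 : ℝ) / 5) ≤ ⌈(rstW m : ℝ) ^ ((1 : ℝ) / 5)⌉₊ ∧
      (⌈(rstW m : ℝ) ^ ((1 : ℝ) / 5)⌉₊ : ℝ) ≤ 2 * m * (2 : ℝ) ^ ((m : ℝ) / 5) ∧ 1 ≤ ⌈(rstW m : ℝ) ^ ((1 : ℝ) / 5)⌉₊ ∧
      8 * (m : ℝ) ≤ ⌈(rstW m : ℝ) ^ ((1 : ℝ) / 5)⌉₊ ∧ (2 : ℝ) ^ ((m : ℝ) / 5) ≤ ⌈(rstW m : ℝ) ^ ((1 : ℝ) / 5)⌉₊ := by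
  have hm2 : 2 ≤ m := le_trans (by norm_num) hm
  have hm' : (128 : ℝ) ≤ m := by exact_mod_cast hm
  have h0 : 0 ≤ (rstW m : ℝ) ^ ((1 : ℝ) / 5) := Real.rpow_nonneg (Nat.cast_nonneg _) _
  have h1 : (rstW m : ℝ) ^ ((1 : ℝ) / 5) ≤ ⌈(rstW m : ℝ) ^ ((1 : ℝ) / 5)⌉₊ := Nat.le_ceil _
  have h2 : (⌈(rstW m : ℝ) ^ ((1 : ℝ) / 5)⌉₊ : ℝ) < (rstW m : ℝ) ^ ((1 : ℝ) / 5) + 1 := Nat.ceil_lt_add_one h0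
  have hup : (rstW m : ℝ) ^ ((1 : ℝ) / 5) ≤ m * (2 : ℝ) ^ ((m : ℝ) / 5) := by
    have := rstW_rpow_le hm2 (e := (1 : ℝ) / 5) (by norm_num)
    rw [show (1 : ℝ) / 5 * m = (m : ℝ) / 5 by ring] at this
    exact this.trans (mul_le_mul_of_nonneg_right (natCast_rpow_le_self (by omega) (by norm_num)) (two_rpow_pos _).le)
  have hlo : (2 : ℝ) ^ ((m : ℝ) / 5) ≤ (rstW m : ℝ) ^ ((1 : ℝ) / 5) := by
    have := rstW_rpow_ge hm2 (e := (1 : ℝ) / 5) (by norm_num)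
    rwa [show (1 : ℝ) / 5 * m = (m : ℝ) / 5 by ring] at this
  have hs3 := hS.s3
  simp only [pow_one] at hs3
  have h8m : 8 * (m : ℝ) ≤ (2 : ℝ) ^ ((m : ℝ) / 5) := by
    have e : (8 * m * (2 : ℝ) ^ (-(m : ℝ) / 5)) * (2 : ℝ) ^ ((m : ℝ) / 5) = 8 * m := by
      rw [mul_assoc, two_rpow_add, show -(m : ℝ) / 5 + (m : ℝ) / 5 = 0 by ring, Real.rpow_zero, mul_one]
    have := mul_le_mul_of_nonneg_right hs3 (two_rpow_pos ((m : ℝ) / 5)).le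
    rw [e, one_mul] at this
    exact this
  have hge1 : (1 : ℝ) ≤ (2 : ℝ) ^ ((m : ℝ) / 5) := Real.one_le_rpow one_le_two (by positivity)
  refine ⟨h1, ?_, ?_, by linarith, by linarith⟩
  · have : (1 : ℝ) ≤ m * (2 : ℝ) ^ ((m : ℝ) / 5) := by nlinarith
    linarith
  · have : (1 : ℝ) ≤ ⌈(rstW m : ℝ) ^ ((1 : ℝ) / 5)⌉₊ := by linarith
    exact_mod_cast this

/-- `ε₀ = 4 t₁ (Δ₀ + 1) ≤ 16 m 2^{-m/12}`. [cite: RossmanServedioTan2015, §10.2 (p. 36, `bias = 1/2 ± o(1)`)] -/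
theorem eps0_le (hm : 128 ≤ m) (hd : 2 ≤ d) (ht : rstT m d 1 ≤ 2 * rstQ m) :
    4 * rstT m d 1 * (rstDelta m d 0 + 1) ≤ 16 * m * (2 : ℝ) ^ (-(m : ℝ) / 12) := by
  have hm2 : 2 ≤ m := le_trans (by norm_num) hm
  have hm' : (128 : ℝ) ≤ m := by exact_mod_cast hm
  have hq := rstQ_pos m
  have hΔ := (rstDelta_bounds hm2 hd 0).1
  have hΔ0 : 0 ≤ rstDelta m d 0 := Real.rpow_nonneg (Nat.cast_nonneg _) _
  have hw := rstW_rpow_le hm2 (e := (5 : ℝ) / 12) (by norm_num)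
  have hm512 : (m : ℝ) ^ ((5 : ℝ) / 12) ≤ m := natCast_rpow_le_self (by omega) (by norm_num)
  have e : rstQ m * (2 : ℝ) ^ ((5 : ℝ) / 12 * m) = (2 : ℝ) ^ (-(m : ℝ) / 12) := by rw [rstQ_eq, two_rpow_add]; ring_nf
  have h1 : rstQ m * rstDelta m d 0 ≤ m * (2 : ℝ) ^ (-(m : ℝ) / 12) := by
    calc rstQ m * rstDelta m d 0 ≤ rstQ m * ((m : ℝ) ^ ((5 : ℝ) / 12) * (2 : ℝ) ^ ((5 : ℝ) / 12 * m)) :=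
          mul_le_mul_of_nonneg_left (hΔ.trans hw) hq.le
      _ = (m : ℝ) ^ ((5 : ℝ) / 12) * (2 : ℝ) ^ (-(m : ℝ) / 12) := by rw [← e]; ring
      _ ≤ m * (2 : ℝ) ^ (-(m : ℝ) / 12) := mul_le_mul_of_nonneg_right hm512 (two_rpow_pos _).le
  have h2 : rstQ m ≤ (2 : ℝ) ^ (-(m : ℝ) / 12) := by rw [rstQ_eq]; exact two_rpow_le (by linarith)
  have h3 : (2 : ℝ) ^ (-(m : ℝ) / 12) ≤ m * (2 : ℝ) ^ (-(m : ℝ) / 12) := by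
    have := two_rpow_pos (-(m : ℝ) / 12); nlinarith
  calc 4 * rstT m d 1 * (rstDelta m d 0 + 1) ≤ 4 * (2 * rstQ m) * (rstDelta m d 0 + 1) :=
        mul_le_mul_of_nonneg_right (by linarith) (by linarith)
    _ = 8 * (rstQ m * rstDelta m d 0) + 8 * rstQ m := by ring
    _ ≤ 8 * (m * (2 : ℝ) ^ (-(m : ℝ) / 12)) + 8 * (m * (2 : ℝ) ^ (-(m : ℝ) / 12)) := by linarith
    _ = 16 * m * (2 : ℝ) ^ (-(m : ℝ) / 12) := by ring

/-- `1/Γ = 16 q³/λ ≤ 16 m² 2^{-m/4}`. [cite: RossmanServedioTan2015, §10.1 Prop. 12 (p. 34, `Γ ≍ λ/q³`)] -/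
theorem inv_Gamma_le (hm : 128 ≤ m) : 1 / (rstLam m / (16 * rstQ m ^ 3)) ≤ 16 * (m : ℝ) ^ 2 * (2 : ℝ) ^ (-(m : ℝ) / 4) := by
  have hm2 : 2 ≤ m := le_trans (by norm_num) hm
  have hm' : (128 : ℝ) ≤ m := by exact_mod_cast hm
  have hm1 : (1 : ℝ) ≤ m := by linarith
  have hq := rstQ_pos m
  have hlam := rstLam_ge' hm2
  have hlam0 : 0 < (m : ℝ) ^ (-(5 : ℝ) / 4) * (2 : ℝ) ^ (-(5 * (m : ℝ) / 4)) := by positivity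
  have hq3 : rstQ m ^ 3 = (2 : ℝ) ^ (-(3 : ℝ) * m / 2) := by
    rw [rstQ_eq, ← Real.rpow_natCast, ← Real.rpow_mul two_pos.le]; push_cast; ring_nf
  rw [one_div_div, div_le_iff₀ (lt_of_lt_of_le hlam0 hlam)]
  have hm54 : (m : ℝ) ^ ((5 : ℝ) / 4) ≤ (m : ℝ) ^ 2 := by
    have : (m : ℝ) ^ ((5 : ℝ) / 4) ≤ (m : ℝ) ^ (2 : ℝ) := Real.rpow_le_rpow_of_exponent_le hm1 (by norm_num)
    rwa [Real.rpow_two] at this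
  -- `16 q³ ≤ 16 m² 2^{-m/4} · m^{-5/4} 2^{-5m/4}` since `m^{5/4} ≤ m²`
  have e : (16 * (m : ℝ) ^ 2 * (2 : ℝ) ^ (-(m : ℝ) / 4)) * ((m : ℝ) ^ (-(5 : ℝ) / 4) * (2 : ℝ) ^ (-(5 * (m : ℝ) / 4))) =
      16 * ((m : ℝ) ^ 2 * (m : ℝ) ^ (-(5 : ℝ) / 4)) * (2 : ℝ) ^ (-(3 : ℝ) * m / 2) := by
    rw [show -(3 : ℝ) * m / 2 = -(m : ℝ) / 4 + -(5 * (m : ℝ) / 4) by ring, ← two_rpow_add]; ring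
  have hkey : (m : ℝ) ^ ((5 : ℝ) / 4) * (m : ℝ) ^ (-(5 : ℝ) / 4) = 1 := by
    rw [← Real.rpow_add (by linarith)]; norm_num
  calc 16 * rstQ m ^ 3 = 16 * ((m : ℝ) ^ ((5 : ℝ) / 4) * (m : ℝ) ^ (-(5 : ℝ) / 4)) * (2 : ℝ) ^ (-(3 : ℝ) * m / 2) := by
        rw [hkey, hq3]; ring
    _ ≤ 16 * ((m : ℝ) ^ 2 * (m : ℝ) ^ (-(5 : ℝ) / 4)) * (2 : ℝ) ^ (-(3 : ℝ) * m / 2) := by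
        apply mul_le_mul_of_nonneg_right _ (two_rpow_pos _).le
        apply mul_le_mul_of_nonneg_left _ (by norm_num)
        exact mul_le_mul_of_nonneg_right hm54 (by positivity)
    _ = _ := by rw [← e]
    _ ≤ _ := by
        apply mul_le_mul_of_nonneg_left hlam (by positivity)

/-- `(1 + x)^n ≤ e^{n x}` for `x ≥ 0`. [folklore] -/
theorem one_add_pow_le_exp {x : ℝ} (hx : 0 ≤ x) (n : ℕ) : (1 + x) ^ n ≤ Real.exp (n * x) := by
  calc (1 + x) ^ n ≤ (Real.exp x) ^ n := pow_le_pow_left₀ (by linarith) (by linarith [Real.add_one_le_exp x]) n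
    _ = Real.exp (n * x) := by rw [← Real.exp_nat_mul]

/-- **The switching-lemma failure is `≤ 2^{-(s+1)}` at every genuine stage** (the base of `δP` is
`≤ 1/2`). [cite: RossmanServedioTan2015, §10.1 Prop. 12 (p. 34) and §11.2 (p. 38)] -/
theorem deltaP_le (hm : 128 ≤ m) (hd : 2 ≤ d) (hS : Small m) (H : RegimeFacts m d) {k : ℕ} (hk1 : 1 ≤ k)
    (hkd : k ≤ d - 1) :
    δP m d ⌈(rstW m : ℝ) ^ ((1 : ℝ) / 5)⌉₊ k (depF (d - 1) ⌈(rstW m : ℝ) ^ ((1 : ℝ) / 5)⌉₊ k) ≤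
      (1 / 2) ^ (⌈(rstW m : ℝ) ^ ((1 : ℝ) / 5)⌉₊ + 1) := by
  obtain ⟨hs1, hs2, hs3, hs8, hs5⟩ := s_bounds hm hS
  set s := ⌈(rstW m : ℝ) ^ ((1 : ℝ) / 5)⌉₊ with hsdef
  have hm' : (128 : ℝ) ≤ m := by exact_mod_cast hm
  have hq := rstQ_pos m
  have hΓ := inv_Gamma_le hm
  have hΓ0 : 0 < rstLam m / (16 * rstQ m ^ 3) := div_pos H.lam_pos (by positivity)
  have h25 := two_rpow_pos ((m : ℝ) / 5)
  unfold δP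
  apply pow_le_pow_left₀
  · apply div_nonneg _ hΓ0.le
    apply mul_nonneg (by positivity)
    apply pow_nonneg
    have h0 : 0 < (rstLaw m d k).t := by
      show 0 < rstTk m d (k + 1); unfold rstTk; split_ifs
      · norm_num
      · exact (H.t_mem (k := k + 1) (by omega) (by omega)).1
    have h1 : (rstLaw m d k).t ≤ 1 / 2 := by
      show rstTk m d (k + 1) ≤ 1 / 2; unfold rstTk; split_ifs
      · exact le_rfl
      · exact (H.t_mem (k := k + 1) (by omega) (by omega)).2.1
    have : 0 ≤ (rstLaw m d k).t / (1 - (rstLaw m d k).t) := div_nonneg h0.le (by linarith)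
    linarith
  · have hinv : (rstLam m / (16 * rstQ m ^ 3))⁻¹ ≤ 16 * (m : ℝ) ^ 2 * (2 : ℝ) ^ (-(m : ℝ) / 4) := by rwa [one_div] at hΓ
    rw [div_eq_mul_inv]
    by_cases htop : k = d - 1
    · -- top stage: width `1`, `t = 1/2`
      have hr : depF (d - 1) s k = 1 := if_pos htop
      have ht : (rstLaw m d k).t = 1 / 2 := by
        show rstTk m d (k + 1) = 1 / 2; unfold rstTk; rw [if_pos (by omega)]
      rw [hr, ht]
      have e : ((8 : ℝ) * ((1 : ℕ) : ℝ) + 10) * (1 + (1 / 2 : ℝ) / (1 - 1 / 2)) ^ (1 + 1) = 72 := by norm_num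
      rw [e]
      have hs10 := hS.s10
      calc (72 : ℝ) * (rstLam m / (16 * rstQ m ^ 3))⁻¹ ≤ 72 * (16 * (m : ℝ) ^ 2 * (2 : ℝ) ^ (-(m : ℝ) / 4)) :=
            mul_le_mul_of_nonneg_left hinv (by norm_num)
        _ = (2304 * (m : ℝ) ^ 2 * (2 : ℝ) ^ (-(m : ℝ) / 4)) / 2 := by ring
        _ ≤ 1 / 2 := by linarith
    · -- below the top: width `s`, `t ≤ 2q`
      have hr : depF (d - 1) s k = s := if_neg htop
      have htk : (rstLaw m d k).t = rstT m d (k + 1) := by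
        show rstTk m d (k + 1) = _; unfold rstTk; rw [if_neg (by omega)]
      obtain ⟨htlo, hthi⟩ := H.t_win (k + 1) (by omega) (by omega)
      rw [hr, htk]
      set t := rstT m d (k + 1) with htdef
      have ht0 : 0 < t := by linarith
      have ht8 : t ≤ 1 / 8 := by linarith [H.q_le]
      have hfrac0 : 0 ≤ t / (1 - t) := div_nonneg ht0.le (by linarith)
      -- `(1 + t/(1-t))^{s+1} ≤ exp(4q(s+1)) ≤ 3`
      have hfrac : t / (1 - t) ≤ 4 * rstQ m := by
        rw [div_le_iff₀ (by linarith)]; nlinarith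
      have hs11 := hS.s11
      simp only [pow_one] at hs11
      have hqs : ((s + 1 : ℕ) : ℝ) * (4 * rstQ m) ≤ 1 := by
        push_cast
        have e : rstQ m * (2 : ℝ) ^ ((m : ℝ) / 5) = (2 : ℝ) ^ (-(m : ℝ) / (10 / 3)) := by
          rw [rstQ_eq, two_rpow_add]; congr 1; ring
        have h1 : (s : ℝ) + 1 ≤ 3 * m * (2 : ℝ) ^ ((m : ℝ) / 5) := by nlinarith
        calc ((s : ℝ) + 1) * (4 * rstQ m) ≤ (3 * m * (2 : ℝ) ^ ((m : ℝ) / 5)) * (4 * rstQ m) :=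
              mul_le_mul_of_nonneg_right h1 (by positivity)
          _ = 12 * m * (rstQ m * (2 : ℝ) ^ ((m : ℝ) / 5)) := by ring
          _ ≤ 1 := by rw [e]; exact hs11
      have hpow : (1 + t / (1 - t)) ^ (s + 1) ≤ 3 := by
        calc (1 + t / (1 - t)) ^ (s + 1) ≤ (1 + 4 * rstQ m) ^ (s + 1) :=
              pow_le_pow_left₀ (by linarith) (by linarith) _
          _ ≤ Real.exp ((s + 1 : ℕ) * (4 * rstQ m)) := one_add_pow_le_exp (by positivity) _
          _ ≤ Real.exp 1 := Real.exp_le_exp.2 hqs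
          _ ≤ 3 := by have := Real.exp_one_lt_d9; linarith
      have hpow0 : 0 ≤ (1 + t / (1 - t)) ^ (s + 1) := pow_nonneg (by linarith) _
      have h8s : (8 : ℝ) * s + 10 ≤ 26 * m * (2 : ℝ) ^ ((m : ℝ) / 5) := by nlinarith
      have hs5' := hS.s5
      -- assemble: `(8s+10) (…)^{s+1} Γ⁻¹ ≤ 26 m 2^{m/5} · 3 · 16 m² 2^{-m/4} = 1248 m³ 2^{-m/20}`
      have e : (26 * m * (2 : ℝ) ^ ((m : ℝ) / 5)) * 3 * (16 * (m : ℝ) ^ 2 * (2 : ℝ) ^ (-(m : ℝ) / 4)) =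
          1248 * (m : ℝ) ^ 3 * (2 : ℝ) ^ (-(m : ℝ) / 20) := by
        have : (2 : ℝ) ^ ((m : ℝ) / 5) * (2 : ℝ) ^ (-(m : ℝ) / 4) = (2 : ℝ) ^ (-(m : ℝ) / 20) := by rw [two_rpow_add]; congr 1; ring
        calc _ = 1248 * (m : ℝ) ^ 3 * ((2 : ℝ) ^ ((m : ℝ) / 5) * (2 : ℝ) ^ (-(m : ℝ) / 4)) := by ring
          _ = _ := by rw [this]
      calc (8 * (s : ℝ) + 10) * (1 + t / (1 - t)) ^ (s + 1) * (rstLam m / (16 * rstQ m ^ 3))⁻¹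
          ≤ (26 * m * (2 : ℝ) ^ ((m : ℝ) / 5)) * 3 * (16 * (m : ℝ) ^ 2 * (2 : ℝ) ^ (-(m : ℝ) / 4)) := by
            apply mul_le_mul _ hinv (inv_nonneg.2 hΓ0.le) (by positivity)
            exact mul_le_mul h8s hpow hpow0 (by positivity)
        _ = 1248 * (m : ℝ) ^ 3 * (2 : ℝ) ^ (-(m : ℝ) / 20) := e
        _ ≤ 1 / 2 := by nlinarith [two_rpow_pos (-(m : ℝ) / 20)]

/-- `n ≤ m w^{d-1}` and `n ≤ 4^{md}` (with `w₀ ≤ w`, `m ≥ 2`). [cite: RossmanServedioTan2015, §6 eq. (10) (p. 15)] -/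
theorem rstN_le (hm : 2 ≤ m) (hd : 2 ≤ d) (hw0 : rstW0 m d ≤ rstW m) :
    rstN m d ≤ m * rstW m ^ (d - 1) ∧ (rstN m d : ℝ) ≤ (2 : ℝ) ^ (2 * (m : ℝ) * d) := by
  have h1 : rstN m d ≤ m * rstW m ^ (d - 1) := by
    rw [rstN_eq]
    calc rstW0 m d * rstW m ^ (d - 2) * m ≤ rstW m * rstW m ^ (d - 2) * m :=
          Nat.mul_le_mul_right _ (Nat.mul_le_mul_right _ hw0)
      _ = m * rstW m ^ (d - 1) := by rw [← pow_succ', show d - 2 + 1 = d - 1 by omega, mul_comm]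
  refine ⟨h1, ?_⟩
  have hw : rstW m ≤ 4 ^ m := by
    have h := (rstW_bounds hm).2
    have : (rstW m : ℝ) ≤ (4 : ℝ) ^ m := by
      calc (rstW m : ℝ) ≤ m * (2 : ℝ) ^ (m : ℝ) := h
        _ ≤ (2 : ℝ) ^ (m : ℝ) * (2 : ℝ) ^ (m : ℝ) := by
            apply mul_le_mul_of_nonneg_right _ (two_rpow_pos _).le
            rw [Real.rpow_natCast]; exact_mod_cast (Nat.lt_two_pow_self).le
        _ = (4 : ℝ) ^ m := by rw [Real.rpow_natCast, ← mul_pow]; norm_num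
    exact_mod_cast this
  have hm4 : m ≤ 4 ^ m := le_trans (Nat.lt_two_pow_self).le (Nat.pow_le_pow_left (by norm_num) m)
  have h2 : rstN m d ≤ 4 ^ (m * d) := by
    calc rstN m d ≤ m * rstW m ^ (d - 1) := h1
      _ ≤ 4 ^ m * (4 ^ m) ^ (d - 1) := Nat.mul_le_mul hm4 (Nat.pow_le_pow_left hw _)
      _ = 4 ^ (m * d) := by rw [← pow_succ', show d - 1 + 1 = d by omega, pow_mul]
  have : (rstN m d : ℝ) ≤ (4 : ℝ) ^ (m * d) := by exact_mod_cast h2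
  refine this.trans (le_of_eq ?_)
  rw [show (4 : ℝ) = 2 ^ (2 : ℝ) by norm_num, ← Real.rpow_natCast, ← Real.rpow_mul two_pos.le]
  push_cast; ring_nf

/-- **The size term**: `S · 2^{-(s+1)} ≤ 2^{-4m}` for `S ≤ 2^{n^{1/(6(d-1))}}`, because
`n^{1/(6(d-1))} ≤ m^{1/3} 2^{m/6} ≤ s/2` and `s ≥ 8m`. [cite: RossmanServedioTan2015, §11.2 (p. 38, "size `S ≤ 2^{n^{1/(6(d-1))}}`")] -/
theorem size_term_le (hm : 128 ≤ m) (hd : 2 ≤ d) (hS : Small m) (hw0 : rstW0 m d ≤ rstW m) {S : ℝ}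
    (hS' : S ≤ (2 : ℝ) ^ ((rstN m d : ℝ) ^ (1 / (6 * ((d : ℝ) - 1))))) :
    S * (1 / 2) ^ (⌈(rstW m : ℝ) ^ ((1 : ℝ) / 5)⌉₊ + 1) ≤ (2 : ℝ) ^ (-(4 * (m : ℝ))) := by
  obtain ⟨hs1, hs2, hs3, hs8, hs5⟩ := s_bounds hm hS
  set s := ⌈(rstW m : ℝ) ^ ((1 : ℝ) / 5)⌉₊ with hsdef
  have hm2 : 2 ≤ m := le_trans (by norm_num) hm
  have hm' : (128 : ℝ) ≤ m := by exact_mod_cast hm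
  have hm1 : (1 : ℝ) ≤ m := by linarith
  have hd' : (2 : ℝ) ≤ d := by exact_mod_cast hd
  have hd1 : (0 : ℝ) < (d : ℝ) - 1 := by linarith
  set e := 1 / (6 * ((d : ℝ) - 1)) with hedef
  have he0 : 0 < e := by rw [hedef]; positivity
  have he6 : e ≤ 1 / 6 := by
    rw [hedef, div_le_div_iff₀ (by positivity) (by norm_num)]; nlinarith
  -- `n^e ≤ m^{1/3} 2^{m/6}`
  have hn := (rstN_le hm2 hd hw0).1
  have hnR : (rstN m d : ℝ) ≤ m * (rstW m : ℝ) ^ ((d : ℝ) - 1) := by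
    have h1 : (rstN m d : ℝ) ≤ ((m * rstW m ^ (d - 1) : ℕ) : ℝ) := by exact_mod_cast hn
    have hpow : ((rstW m : ℝ)) ^ (d - 1) = (rstW m : ℝ) ^ ((d : ℝ) - 1) := by
      rw [← Real.rpow_natCast]
      congr 1
      push_cast [Nat.cast_sub (by omega : 1 ≤ d)]
      ring
    rw [Nat.cast_mul, Nat.cast_pow, hpow] at h1
    exact h1
  have hwpos := (rstW_pos hm2).2
  have hne : (rstN m d : ℝ) ^ e ≤ (m : ℝ) ^ ((1 : ℝ) / 3) * (2 : ℝ) ^ ((m : ℝ) / 6) := by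
    calc (rstN m d : ℝ) ^ e ≤ (m * (rstW m : ℝ) ^ ((d : ℝ) - 1)) ^ e := Real.rpow_le_rpow (Nat.cast_nonneg _) hnR he0.le
      _ = (m : ℝ) ^ e * (rstW m : ℝ) ^ ((1 : ℝ) / 6) := by
          rw [Real.mul_rpow (Nat.cast_nonneg _) (Real.rpow_nonneg (Nat.cast_nonneg _) _), ← Real.rpow_mul (Nat.cast_nonneg _)]
          congr 2
          rw [hedef]; field_simp
      _ ≤ (m : ℝ) ^ ((1 : ℝ) / 6) * ((m : ℝ) ^ ((1 : ℝ) / 6) * (2 : ℝ) ^ ((1 : ℝ) / 6 * m)) :=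
          mul_le_mul (Real.rpow_le_rpow_of_exponent_le hm1 he6) (rstW_rpow_le hm2 (by norm_num))
            (Real.rpow_nonneg (Nat.cast_nonneg _) _) (Real.rpow_nonneg (Nat.cast_nonneg _) _)
      _ = (m : ℝ) ^ ((1 : ℝ) / 3) * (2 : ℝ) ^ ((m : ℝ) / 6) := by
          rw [← mul_assoc, ← Real.rpow_add (by linarith : (0 : ℝ) < m)]
          congr 1
          · norm_num
          · congr 1; ring
  -- `m^{1/3} 2^{m/6} ≤ s/2`
  have hs4 := hS.s4
  simp only [pow_one] at hs4
  have hm13 : (m : ℝ) ^ ((1 : ℝ) / 3) ≤ m := natCast_rpow_le_self (by omega) (by norm_num)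
  have hhalf : (m : ℝ) ^ ((1 : ℝ) / 3) * (2 : ℝ) ^ ((m : ℝ) / 6) ≤ s / 2 := by
    have e1 : (m : ℝ) * (2 : ℝ) ^ ((m : ℝ) / 6) = (4 * m * (2 : ℝ) ^ (-(m : ℝ) / 30)) * ((2 : ℝ) ^ ((m : ℝ) / 5) / 4) := by
      have : (2 : ℝ) ^ ((m : ℝ) / 6) = (2 : ℝ) ^ (-(m : ℝ) / 30) * (2 : ℝ) ^ ((m : ℝ) / 5) := by rw [two_rpow_add]; congr 1; ring
      rw [this]; ring
    have h1 : (m : ℝ) ^ ((1 : ℝ) / 3) * (2 : ℝ) ^ ((m : ℝ) / 6) ≤ m * (2 : ℝ) ^ ((m : ℝ) / 6) :=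
      mul_le_mul_of_nonneg_right hm13 (two_rpow_pos _).le
    have h2 : (4 * m * (2 : ℝ) ^ (-(m : ℝ) / 30)) * ((2 : ℝ) ^ ((m : ℝ) / 5) / 4) ≤ 1 * ((2 : ℝ) ^ ((m : ℝ) / 5) / 4) :=
      mul_le_mul_of_nonneg_right hs4 (by positivity)
    linarith
  -- conclude
  have hS2 : S ≤ (2 : ℝ) ^ ((s : ℝ) / 2) := hS'.trans (two_rpow_le (by linarith))
  have hhalfpow : ((1 : ℝ) / 2) ^ (s + 1) = (2 : ℝ) ^ (-((s : ℝ) + 1)) := by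
    rw [Real.rpow_neg two_pos.le, one_div, inv_pow, ← Real.rpow_natCast]; push_cast; rfl
  rw [hhalfpow]
  calc S * (2 : ℝ) ^ (-((s : ℝ) + 1)) ≤ (2 : ℝ) ^ ((s : ℝ) / 2) * (2 : ℝ) ^ (-((s : ℝ) + 1)) :=
        mul_le_mul_of_nonneg_right hS2 (two_rpow_pos _).le
    _ = (2 : ℝ) ^ ((s : ℝ) / 2 + -((s : ℝ) + 1)) := two_rpow_add _ _
    _ ≤ (2 : ℝ) ^ (-(4 * (m : ℝ))) := two_rpow_le (by linarith)

set_option maxHeartbeats 1000000 in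
/-- **The typicality loss is negligible**: `δT ≤ 3 e^{-m} + 4 m² 2^{-m/4}` (the last term is `w λ`). [cite: RossmanServedioTan2015, §10.1 Props. 10–11 (p. 32, "with probability `1 - o(1)`")] -/
theorem deltaT_le (hm : 128 ≤ m) (hd : 2 ≤ d) (hS : Small m) (hdm : d ≤ m) (hw0 : rstW0 m d ≤ rstW m) :
    δT m d ⌊(rstW m : ℝ) ^ ((4 : ℝ) / 5)⌋₊ ≤ 3 * Real.exp (-(m : ℝ)) + 4 * (m : ℝ) ^ 2 * (2 : ℝ) ^ (-(m : ℝ) / 4) := by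
  have hm2 : 2 ≤ m := le_trans (by norm_num) hm
  have hm' : (128 : ℝ) ≤ m := by exact_mod_cast hm
  have hm1 : (1 : ℝ) ≤ m := by linarith
  have hm0 : (0 : ℝ) < m := by linarith
  have hq := rstQ_pos m
  obtain ⟨hw1, hwpos⟩ := rstW_pos hm2
  obtain ⟨hwlo, hwhi⟩ := rstW_bounds hm2
  have hwl := rstW_mul_rstLam_le hm2
  have hlam := rstLam_nonneg m
  -- `N ≤ exp(2 m²)`
  have hN : (rstN m d : ℝ) ≤ Real.exp (2 * (m : ℝ) ^ 2) := by
    refine (rstN_le hm2 hd hw0).2.trans ((two_rpow_le_exp (by positivity)).trans (Real.exp_le_exp.2 ?_))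
    have : (d : ℝ) ≤ m := by exact_mod_cast hdm
    nlinarith
  have hN0 : (0 : ℝ) ≤ rstN m d := Nat.cast_nonneg _
  -- `e_A ≤ exp(-2^{m/6}/(64 m))`
  set u := (rstW m : ℝ) ^ ((1 : ℝ) / 3) with hu
  have hu0 : 0 < u := Real.rpow_pos_of_pos hwpos _
  have hu3 : u ^ 3 = rstW m := by
    rw [hu, ← Real.rpow_natCast, ← Real.rpow_mul (Nat.cast_nonneg _)]; norm_num
  have hule : u ≤ m * (2 : ℝ) ^ ((m : ℝ) / 3) := by
    have := rstW_rpow_le hm2 (e := (1 : ℝ) / 3) (by norm_num)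
    rw [show (1 : ℝ) / 3 * m = (m : ℝ) / 3 by ring] at this
    exact this.trans (mul_le_mul_of_nonneg_right (natCast_rpow_le_self (by omega) (by norm_num)) (two_rpow_pos _).le)
  have huq : u * rstQ m ≤ m * (2 : ℝ) ^ (-(m : ℝ) / 6) := by
    have e : (m * (2 : ℝ) ^ ((m : ℝ) / 3)) * rstQ m = m * (2 : ℝ) ^ (-(m : ℝ) / 6) := by
      rw [rstQ_eq, mul_assoc, two_rpow_add]; congr 2; ring
    rw [← e]; exact mul_le_mul_of_nonneg_right hule hq.le
  have heA : Real.exp (-(((rstW m : ℝ) ^ ((1 : ℝ) / 3) / 2) ^ 2 / (16 * (rstW m * rstQ m)))) ≤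
      Real.exp (-((2 : ℝ) ^ ((m : ℝ) / 6) / (64 * m))) := by
    rw [Real.exp_le_exp, neg_le_neg_iff, ← hu, ← hu3]
    have e : (u / 2) ^ 2 / (16 * (u ^ 3 * rstQ m)) = 1 / (64 * (u * rstQ m)) := by
      field_simp; ring
    rw [e, div_le_div_iff₀ (by positivity) (by positivity), one_mul]
    have h26 := two_rpow_pos ((m : ℝ) / 6)
    have e2 : (2 : ℝ) ^ ((m : ℝ) / 6) * (m * (2 : ℝ) ^ (-(m : ℝ) / 6)) = m := by
      rw [mul_left_comm, two_rpow_add, show (m : ℝ) / 6 + -(m : ℝ) / 6 = 0 by ring, Real.rpow_zero, mul_one]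
    have h3 := mul_le_mul_of_nonneg_left huq h26.le
    rw [e2] at h3
    have e4 : (2 : ℝ) ^ ((m : ℝ) / 6) * (64 * (u * rstQ m)) = 64 * ((2 : ℝ) ^ ((m : ℝ) / 6) * (u * rstQ m)) := by ring
    rw [e4]
    linarith
  have hs6 := hS.s6
  have hNeA : (rstN m d : ℝ) * Real.exp (-(((rstW m : ℝ) ^ ((1 : ℝ) / 3) / 2) ^ 2 / (16 * (rstW m * rstQ m)))) ≤ Real.exp (-(m : ℝ)) := by
    calc _ ≤ Real.exp (2 * (m : ℝ) ^ 2) * Real.exp (-((2 : ℝ) ^ ((m : ℝ) / 6) / (64 * m))) :=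
          mul_le_mul hN heA (Real.exp_pos _).le (Real.exp_pos _).le
      _ = Real.exp (2 * (m : ℝ) ^ 2 - (2 : ℝ) ^ ((m : ℝ) / 6) / (64 * m)) := by rw [← Real.exp_add]; ring_nf
      _ ≤ Real.exp (-(m : ℝ)) := by
          rw [Real.exp_le_exp]
          -- `192 m³ ≤ 2^{m/6}`
          have h192 : 192 * (m : ℝ) ^ 3 ≤ (2 : ℝ) ^ ((m : ℝ) / 6) := by
            have e : (192 * (m : ℝ) ^ 3 * (2 : ℝ) ^ (-(m : ℝ) / 6)) * (2 : ℝ) ^ ((m : ℝ) / 6) = 192 * (m : ℝ) ^ 3 := by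
              rw [mul_assoc, two_rpow_add, show -(m : ℝ) / 6 + (m : ℝ) / 6 = 0 by ring, Real.rpow_zero, mul_one]
            have := mul_le_mul_of_nonneg_right hs6 (two_rpow_pos ((m : ℝ) / 6)).le
            rw [e, one_mul] at this; exact this
          have hA : 3 * (m : ℝ) ^ 2 ≤ (2 : ℝ) ^ ((m : ℝ) / 6) / (64 * m) := by
            rw [le_div_iff₀ (by positivity)]
            have : 3 * (m : ℝ) ^ 2 * (64 * m) = 192 * (m : ℝ) ^ 3 := by ring
            linarith
          have hmm : (m : ℝ) ≤ (m : ℝ) ^ 2 := by nlinarith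
          linarith
  -- `e_B ≤ exp(-2^{4m/5}/2)`
  set E := ⌊(rstW m : ℝ) ^ ((4 : ℝ) / 5)⌋₊ with hE
  have hE1 : (rstW m : ℝ) ^ ((4 : ℝ) / 5) ≤ (E : ℝ) + 1 := (Nat.lt_floor_add_one _).le
  have hE2 : (2 : ℝ) ^ ((4 : ℝ) / 5 * m) ≤ (rstW m : ℝ) ^ ((4 : ℝ) / 5) := rstW_rpow_ge hm2 (by norm_num)
  have hc : (1 - rstQ m / 2) ^ ((rstW m : ℝ) / 2) ≤ Real.exp (-((2 : ℝ) ^ ((m : ℝ) / 2) / 4)) := by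
    refine (one_sub_rpow_le_exp_neg (t := rstQ m / 2) (by linarith [rstQ_le_one m]) (by positivity)).trans ?_
    rw [Real.exp_le_exp, neg_le_neg_iff]
    have : (2 : ℝ) ^ ((m : ℝ) / 2) ≤ rstW m * rstQ m := by
      have e : (2 : ℝ) ^ (m : ℝ) * rstQ m = (2 : ℝ) ^ ((m : ℝ) / 2) := by rw [rstQ_eq, two_rpow_add]; congr 1; ring
      rw [← e]; exact mul_le_mul_of_nonneg_right hwlo hq.le
    nlinarith
  have hs9 := hS.s9
  have hwc : (rstW m : ℝ) * (1 - rstQ m / 2) ^ ((rstW m : ℝ) / 2) ≤ 1 := by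
    have h8m : 8 * (m : ℝ) ≤ (2 : ℝ) ^ ((m : ℝ) / 2) := by
      have e : (12 * (m : ℝ) ^ 3 * (2 : ℝ) ^ (-(m : ℝ) / 2)) * (2 : ℝ) ^ ((m : ℝ) / 2) = 12 * (m : ℝ) ^ 3 := by
        rw [mul_assoc, two_rpow_add, show -(m : ℝ) / 2 + (m : ℝ) / 2 = 0 by ring, Real.rpow_zero, mul_one]
      have := mul_le_mul_of_nonneg_right hs9 (two_rpow_pos ((m : ℝ) / 2)).le
      rw [e, one_mul] at this
      have hm3' : (m : ℝ) ≤ (m : ℝ) ^ 3 := by nlinarith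
      linarith
    have hwexp : (rstW m : ℝ) ≤ Real.exp (2 * m) := by
      calc (rstW m : ℝ) ≤ m * (2 : ℝ) ^ (m : ℝ) := hwhi
        _ ≤ (2 : ℝ) ^ (m : ℝ) * (2 : ℝ) ^ (m : ℝ) := by
            apply mul_le_mul_of_nonneg_right _ (two_rpow_pos _).le
            rw [Real.rpow_natCast]; exact_mod_cast (Nat.lt_two_pow_self).le
        _ = (2 : ℝ) ^ (2 * (m : ℝ)) := by rw [two_rpow_add]; ring_nf
        _ ≤ Real.exp (2 * m) := two_rpow_le_exp (by positivity)
    calc (rstW m : ℝ) * (1 - rstQ m / 2) ^ ((rstW m : ℝ) / 2) ≤ Real.exp (2 * m) * Real.exp (-((2 : ℝ) ^ ((m : ℝ) / 2) / 4)) :=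
          mul_le_mul hwexp hc (Real.rpow_nonneg (by linarith [rstQ_le_one m]) _) (Real.exp_pos _).le
      _ = Real.exp (2 * m - (2 : ℝ) ^ ((m : ℝ) / 2) / 4) := by rw [← Real.exp_add]; ring_nf
      _ ≤ Real.exp 0 := Real.exp_le_exp.2 (by linarith)
      _ = 1 := Real.exp_zero
  have hwwl : (rstW m : ℝ) * (rstW m * rstLam m) ≤ 4 * (m : ℝ) ^ 3 * (2 : ℝ) ^ (3 * (m : ℝ) / 4) := by
    calc (rstW m : ℝ) * (rstW m * rstLam m) ≤ (m * (2 : ℝ) ^ (m : ℝ)) * (4 * (m : ℝ) ^ 2 * (2 : ℝ) ^ (-(m : ℝ) / 4)) :=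
          mul_le_mul hwhi hwl (mul_nonneg hwpos.le hlam) (by positivity)
      _ = 4 * (m : ℝ) ^ 3 * ((2 : ℝ) ^ (m : ℝ) * (2 : ℝ) ^ (-(m : ℝ) / 4)) := by ring
      _ = _ := by rw [two_rpow_add]; congr 2; ring
  have hs5 := hS.s5
  have hexpB : 2 * (rstW m * (rstW m * rstLam m + (1 - rstQ m / 2) ^ ((rstW m : ℝ) / 2))) - ((E : ℝ) + 1) ≤
      -((2 : ℝ) ^ ((4 : ℝ) / 5 * m) / 2) := by
    have h20 : 20 * (m : ℝ) ^ 3 * (2 : ℝ) ^ (3 * (m : ℝ) / 4) ≤ (2 : ℝ) ^ ((4 : ℝ) / 5 * m) := by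
      have e : (20 * (m : ℝ) ^ 3 * (2 : ℝ) ^ (-(m : ℝ) / 20)) * (2 : ℝ) ^ ((4 : ℝ) / 5 * m) = 20 * (m : ℝ) ^ 3 * (2 : ℝ) ^ (3 * (m : ℝ) / 4) := by
        rw [mul_assoc, two_rpow_add]; congr 2; ring
      have h : 20 * (m : ℝ) ^ 3 * (2 : ℝ) ^ (-(m : ℝ) / 20) ≤ 1 := by
        have := two_rpow_pos (-(m : ℝ) / 20)
        have hm3pos : 0 ≤ (m : ℝ) ^ 3 := by positivity
        nlinarith [mul_nonneg hm3pos this.le]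
      have := mul_le_mul_of_nonneg_right h (two_rpow_pos ((4 : ℝ) / 5 * m)).le
      rw [e, one_mul] at this; exact this
    have h2 : (2 : ℝ) ≤ 2 * (m : ℝ) ^ 3 * (2 : ℝ) ^ (3 * (m : ℝ) / 4) := by
      have h1' : (1 : ℝ) ≤ (2 : ℝ) ^ (3 * (m : ℝ) / 4) := Real.one_le_rpow one_le_two (by positivity)
      have hm3' : (1 : ℝ) ≤ (m : ℝ) ^ 3 := by nlinarith
      nlinarith
    have hx : (rstW m : ℝ) * (rstW m * rstLam m + (1 - rstQ m / 2) ^ ((rstW m : ℝ) / 2)) =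
        rstW m * (rstW m * rstLam m) + rstW m * (1 - rstQ m / 2) ^ ((rstW m : ℝ) / 2) := mul_add _ _ _
    rw [hx]
    linarith
  have hs12 := hS.s12
  have hNeB : (rstN m d : ℝ) * Real.exp (2 * (rstW m * (rstW m * rstLam m + (1 - rstQ m / 2) ^ ((rstW m : ℝ) / 2))) - ((E : ℝ) + 1)) ≤
      Real.exp (-(m : ℝ)) := by
    calc _ ≤ Real.exp (2 * (m : ℝ) ^ 2) * Real.exp (-((2 : ℝ) ^ ((4 : ℝ) / 5 * m) / 2)) :=
          mul_le_mul hN (Real.exp_le_exp.2 hexpB) (Real.exp_pos _).le (Real.exp_pos _).le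
      _ = Real.exp (2 * (m : ℝ) ^ 2 - (2 : ℝ) ^ ((4 : ℝ) / 5 * m) / 2) := by rw [← Real.exp_add]; ring_nf
      _ ≤ Real.exp (-(m : ℝ)) := by
          rw [Real.exp_le_exp]
          have h6 : 6 * (m : ℝ) ^ 2 ≤ (2 : ℝ) ^ ((4 : ℝ) / 5 * m) := by
            have e : (6 * (m : ℝ) ^ 2 * (2 : ℝ) ^ (-(m : ℝ) / (5 / 4))) * (2 : ℝ) ^ ((4 : ℝ) / 5 * m) = 6 * (m : ℝ) ^ 2 := by
              rw [mul_assoc, two_rpow_add, show -(m : ℝ) / (5 / 4) + (4 : ℝ) / 5 * m = 0 by ring, Real.rpow_zero, mul_one]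
            have := mul_le_mul_of_nonneg_right hs12 (two_rpow_pos ((4 : ℝ) / 5 * m)).le
            rw [e, one_mul] at this; exact this
          have hmm : (m : ℝ) ≤ (m : ℝ) ^ 2 := by nlinarith
          linarith
  -- assemble
  unfold δT
  have e3 : (rstN m d : ℝ) * (2 * Real.exp (-(((rstW m : ℝ) ^ ((1 : ℝ) / 3) / 2) ^ 2 / (16 * (rstW m * rstQ m)))) +
      Real.exp (2 * (rstW m * (rstW m * rstLam m + (1 - rstQ m / 2) ^ ((rstW m : ℝ) / 2))) - ((E : ℝ) + 1))) =
      2 * ((rstN m d : ℝ) * Real.exp (-(((rstW m : ℝ) ^ ((1 : ℝ) / 3) / 2) ^ 2 / (16 * (rstW m * rstQ m))))) +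
      (rstN m d : ℝ) * Real.exp (2 * (rstW m * (rstW m * rstLam m + (1 - rstQ m / 2) ^ ((rstW m : ℝ) / 2))) - ((E : ℝ) + 1)) := by ring
  rw [e3]
  linarith

set_option maxHeartbeats 1000000 in
/-- **The error budget**: with `s = ⌈w^{1/5}⌉`, `E = ⌊w^{4/5}⌋`, `ε₀ = 4 t₁ (Δ₀ + 1)` and a size bound
`S ≤ 2^{n^{1/(6(d-1))}}`, the total error of `agreement_le` is at most `2^{-m/24} ≤ n^{-1/(48d)}`
for large `m` in the regime. [cite: RossmanServedioTan2015, §11.2 (pp. 37–38, the final `o(1)` bookkeeping of Theorem 1)] -/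
theorem budget (hm : 128 ≤ m) (hd : 2 ≤ d) (hS : Small m) (H : RegimeFacts m d) (hdm : d ≤ m) (hw0 : rstW0 m d ≤ rstW m)
    (hNpos : 0 < rstN m d) {S : ℕ} (hS' : (S : ℝ) ≤ (2 : ℝ) ^ ((rstN m d : ℝ) ^ (1 / (6 * ((d : ℝ) - 1))))) :
    ProcParams.errTot (4 * rstT m d 1 * (rstDelta m d 0 + 1)) (⌈(rstW m : ℝ) ^ ((1 : ℝ) / 5)⌉₊ * rstT m d 1)
        (fun _ => δT m d ⌊(rstW m : ℝ) ^ ((4 : ℝ) / 5)⌋₊)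
        (fun k => δP m d ⌈(rstW m : ℝ) ^ ((1 : ℝ) / 5)⌉₊ k (depF (d - 1) ⌈(rstW m : ℝ) ^ ((1 : ℝ) / 5)⌉₊ k)) S (d - 1) ≤
      (rstN m d : ℝ) ^ (-(1 / 48) / (d : ℝ)) := by
  obtain ⟨hs1, hs2, hs3, hs8, hs5⟩ := s_bounds hm hS
  set s := ⌈(rstW m : ℝ) ^ ((1 : ℝ) / 5)⌉₊ with hsdef
  have hm2 : 2 ≤ m := le_trans (by norm_num) hm
  have hm' : (128 : ℝ) ≤ m := by exact_mod_cast hm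
  have hm1 : (1 : ℝ) ≤ m := by linarith
  have hq := rstQ_pos m
  have hd' : (2 : ℝ) ≤ d := by exact_mod_cast hd
  have hdm' : ((d - 1 : ℕ) : ℝ) ≤ m := by
    have : d - 1 ≤ m := by omega
    exact_mod_cast this
  obtain ⟨htlo, hthi⟩ := H.t_win 1 le_rfl (by omega)
  -- the five terms
  have hε := eps0_le hm hd hthi
  have hst : (s : ℝ) * rstT m d 1 ≤ 4 * m * (2 : ℝ) ^ (-(3 : ℝ) * m / 10) := by
    have e : (2 * m * (2 : ℝ) ^ ((m : ℝ) / 5)) * (2 * rstQ m) = 4 * m * (2 : ℝ) ^ (-(3 : ℝ) * m / 10) := by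
      rw [rstQ_eq]
      calc _ = 4 * m * ((2 : ℝ) ^ ((m : ℝ) / 5) * (2 : ℝ) ^ (-(m : ℝ) / 2)) := by ring
        _ = _ := by rw [two_rpow_add]; congr 2; ring
    rw [← e]
    exact mul_le_mul hs2 hthi (by linarith) (by positivity)
  have hT := deltaT_le hm hd hS hdm hw0
  have hsum : ∑ i ∈ Finset.range (d - 1), (δT m d ⌊(rstW m : ℝ) ^ ((4 : ℝ) / 5)⌋₊ +
      (S : ℝ) * δP m d s (i + 1) (depF (d - 1) s (i + 1))) ≤
      ((d - 1 : ℕ) : ℝ) * (3 * Real.exp (-(m : ℝ)) + 4 * (m : ℝ) ^ 2 * (2 : ℝ) ^ (-(m : ℝ) / 4) + (2 : ℝ) ^ (-(4 * (m : ℝ)))) := by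
    have hterm : ∀ i ∈ Finset.range (d - 1), δT m d ⌊(rstW m : ℝ) ^ ((4 : ℝ) / 5)⌋₊ + (S : ℝ) * δP m d s (i + 1) (depF (d - 1) s (i + 1)) ≤
        3 * Real.exp (-(m : ℝ)) + 4 * (m : ℝ) ^ 2 * (2 : ℝ) ^ (-(m : ℝ) / 4) + (2 : ℝ) ^ (-(4 * (m : ℝ))) := by
      intro i hi
      have hi' := Finset.mem_range.1 hi
      have hP := deltaP_le hm hd hS H (k := i + 1) (by omega) (by omega)
      have hsz := size_term_le hm hd hS hw0 hS'
      have : (S : ℝ) * δP m d s (i + 1) (depF (d - 1) s (i + 1)) ≤ (2 : ℝ) ^ (-(4 * (m : ℝ))) :=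
        (mul_le_mul_of_nonneg_left hP (Nat.cast_nonneg S)).trans hsz
      linarith
    calc _ ≤ ∑ _i ∈ Finset.range (d - 1), (3 * Real.exp (-(m : ℝ)) + 4 * (m : ℝ) ^ 2 * (2 : ℝ) ^ (-(m : ℝ) / 4) + (2 : ℝ) ^ (-(4 * (m : ℝ)))) :=
          Finset.sum_le_sum hterm
      _ = _ := by rw [Finset.sum_const, Finset.card_range, nsmul_eq_mul]
  -- each term is `≤ 2^{-m/24}/6`
  set B := (2 : ℝ) ^ (-(m : ℝ) / 24) with hB
  have hB0 : 0 < B := two_rpow_pos _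
  have ha : 16 * m * (2 : ℝ) ^ (-(m : ℝ) / 12) ≤ B / 6 := by
    have hs7 := hS.s7
    simp only [pow_one] at hs7
    have e : 16 * m * (2 : ℝ) ^ (-(m : ℝ) / 12) = (96 * m * (2 : ℝ) ^ (-(m : ℝ) / 24)) * (B / 6) := by
      rw [hB]
      calc _ = 16 * m * ((2 : ℝ) ^ (-(m : ℝ) / 24) * (2 : ℝ) ^ (-(m : ℝ) / 24)) := by rw [two_rpow_add]; congr 2; ring
        _ = _ := by ring
    rw [e]; exact mul_le_of_le_one_left (by positivity) hs7
  have hb : 4 * m * (2 : ℝ) ^ (-(3 : ℝ) * m / 10) ≤ B / 6 := by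
    have hs1' := hS.s1
    have h1 : (2 : ℝ) ^ (-(3 : ℝ) * m / 10) ≤ (2 : ℝ) ^ (-(m : ℝ) / 4) * B := by
      rw [hB, two_rpow_add]; exact two_rpow_le (by linarith)
    have h2 : 24 * m * (2 : ℝ) ^ (-(m : ℝ) / 4) ≤ 1 := by
      have hmm : 24 * (m : ℝ) ≤ 16 * (m : ℝ) ^ 3 := by nlinarith
      have := mul_le_mul_of_nonneg_right hmm (two_rpow_pos (-(m : ℝ) / 4)).le
      linarith
    calc 4 * m * (2 : ℝ) ^ (-(3 : ℝ) * m / 10) ≤ 4 * m * ((2 : ℝ) ^ (-(m : ℝ) / 4) * B) :=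
          mul_le_mul_of_nonneg_left h1 (by positivity)
      _ = (24 * m * (2 : ℝ) ^ (-(m : ℝ) / 4)) * (B / 6) := by ring
      _ ≤ 1 * (B / 6) := mul_le_mul_of_nonneg_right h2 (by positivity)
      _ = B / 6 := one_mul _
  have hs9 := hS.s9
  have h2mB : (2 : ℝ) ^ (-(m : ℝ)) ≤ (2 : ℝ) ^ (-(m : ℝ) / 2) * B := by
    rw [hB, two_rpow_add]; exact two_rpow_le (by linarith)
  have h18 : 18 * m * (2 : ℝ) ^ (-(m : ℝ) / 2) ≤ 1 := by
    have hmm : 18 * (m : ℝ) ≤ 12 * (m : ℝ) ^ 3 := by nlinarith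
    have := mul_le_mul_of_nonneg_right hmm (two_rpow_pos (-(m : ℝ) / 2)).le
    linarith
  have hc : (m : ℝ) * (3 * Real.exp (-(m : ℝ))) ≤ B / 6 := by
    have hexp : Real.exp (-(m : ℝ)) ≤ (2 : ℝ) ^ (-(m : ℝ)) := by
      rw [Real.rpow_neg two_pos.le, Real.exp_neg]
      exact inv_anti₀ (two_rpow_pos _) (two_rpow_le_exp (Nat.cast_nonneg _))
    calc (m : ℝ) * (3 * Real.exp (-(m : ℝ))) ≤ m * (3 * ((2 : ℝ) ^ (-(m : ℝ) / 2) * B)) := by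
          apply mul_le_mul_of_nonneg_left _ (by positivity); linarith
      _ = (18 * m * (2 : ℝ) ^ (-(m : ℝ) / 2)) * (B / 6) := by ring
      _ ≤ 1 * (B / 6) := mul_le_mul_of_nonneg_right h18 (by positivity)
      _ = B / 6 := one_mul _
  have hdd : (m : ℝ) * (4 * (m : ℝ) ^ 2 * (2 : ℝ) ^ (-(m : ℝ) / 4)) ≤ B / 6 := by
    have hs8' := hS.s8
    have e : (m : ℝ) * (4 * (m : ℝ) ^ 2 * (2 : ℝ) ^ (-(m : ℝ) / 4)) = (24 * (m : ℝ) ^ 3 * (2 : ℝ) ^ (-(m : ℝ) / (24 / 5))) * (B / 6) := by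
      rw [hB]
      calc _ = 4 * (m : ℝ) ^ 3 * (2 : ℝ) ^ (-(m : ℝ) / 4) := by ring
        _ = 4 * (m : ℝ) ^ 3 * ((2 : ℝ) ^ (-(m : ℝ) / (24 / 5)) * (2 : ℝ) ^ (-(m : ℝ) / 24)) := by rw [two_rpow_add]; congr 2; ring
        _ = _ := by ring
    rw [e]; exact mul_le_of_le_one_left (by positivity) hs8'
  have he : (m : ℝ) * (2 : ℝ) ^ (-(4 * (m : ℝ))) ≤ B / 6 := by
    have h1 : (2 : ℝ) ^ (-(4 * (m : ℝ))) ≤ (2 : ℝ) ^ (-(m : ℝ) / 2) * B := by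
      rw [hB, two_rpow_add]; exact two_rpow_le (by linarith)
    calc (m : ℝ) * (2 : ℝ) ^ (-(4 * (m : ℝ))) ≤ m * ((2 : ℝ) ^ (-(m : ℝ) / 2) * B) := mul_le_mul_of_nonneg_left h1 (by positivity)
      _ = (6 * m * (2 : ℝ) ^ (-(m : ℝ) / 2)) * (B / 6) := by ring
      _ ≤ 1 * (B / 6) := mul_le_mul_of_nonneg_right (by linarith) (by positivity)
      _ = B / 6 := one_mul _
  -- `2^{-m/24} ≤ n^{-1/(48 d)}`
  have hBN : B ≤ (rstN m d : ℝ) ^ (-(1 / 48) / (d : ℝ)) := by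
    have hN := (rstN_le hm2 hd hw0).2
    have hNpos : (0 : ℝ) < rstN m d := by exact_mod_cast hNpos
    have hz : -(1 / 48) / (d : ℝ) ≤ 0 := div_nonpos_of_nonpos_of_nonneg (by norm_num) (by linarith)
    refine le_trans (le_of_eq ?_) (Real.rpow_le_rpow_of_nonpos hNpos hN hz)
    rw [hB, ← Real.rpow_mul two_pos.le]
    congr 1
    field_simp
    ring
  -- total
  unfold ProcParams.errTot
  have hsum' : ∑ i ∈ Finset.range (d - 1), (δT m d ⌊(rstW m : ℝ) ^ ((4 : ℝ) / 5)⌋₊ + (S : ℝ) * δP m d s (i + 1) (depF (d - 1) s (i + 1))) ≤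
      3 * (B / 6) := by
    refine hsum.trans ?_
    have hpos : 0 ≤ 3 * Real.exp (-(m : ℝ)) + 4 * (m : ℝ) ^ 2 * (2 : ℝ) ^ (-(m : ℝ) / 4) + (2 : ℝ) ^ (-(4 * (m : ℝ))) := by positivity
    calc ((d - 1 : ℕ) : ℝ) * (3 * Real.exp (-(m : ℝ)) + 4 * (m : ℝ) ^ 2 * (2 : ℝ) ^ (-(m : ℝ) / 4) + (2 : ℝ) ^ (-(4 * (m : ℝ))))
        ≤ m * (3 * Real.exp (-(m : ℝ)) + 4 * (m : ℝ) ^ 2 * (2 : ℝ) ^ (-(m : ℝ) / 4) + (2 : ℝ) ^ (-(4 * (m : ℝ)))) :=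
          mul_le_mul_of_nonneg_right hdm' hpos
      _ ≤ 3 * (B / 6) := by linarith
  linarith

end Budget

/-! ### The discharge -/

/-- **Rossman–Servedio–Tan 2015, Theorem 1 (in the regime of Lemma 7.1)** — discharge of the
named fact `rossmanServedioTan2015_thm1_inRegime`, with `c = min(c_{7.1}, c_{w₀}, 1/64)` and
`C = 1/48`: for `m ≥ m₀` and `2 ≤ d ≤ c m / log₂ m`, every `{∧,∨,¬}` circuit of depth `≤ d-1` and
size `≤ 2^{n^{1/(6(d-1))}}` agrees with `Sipser_d` on at most `(1/2 + n^{-C/d}) 2ⁿ` inputs.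
Proof: `agreement_le` (RST §11.2) with the parameter facts of `…AsymA` and the error budget
`budget`; the inputs `|t_k - q| ≤ q^{1.1}` and `w₀ = 2^m ln 2 (1 ± 1/2)` are the landed Lemma 7.1
and §6 asymptotics. [cite: RossmanServedioTan2015, Theorem 1 (p. 3); proof §11.2 (pp. 37–38)] -/
theorem rst_thm1_inRegime_proof : rossmanServedioTan2015_thm1_inRegime := by
  classical
  obtain ⟨c₁, hc₁, h71⟩ := rossmanServedioTan2015_lem71_holds
  obtain ⟨c₂, hc₂, hw0⟩ := rossmanServedioTan2015_w0_asymp_holds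
  obtain ⟨m₁, hm₁⟩ := hw0 (1 / 2) (by norm_num)
  obtain ⟨m₂, hm₂⟩ := small_eventually
  refine ⟨min c₁ (min c₂ (1 / 64)), lt_min hc₁ (lt_min hc₂ (by norm_num)), 1 / 48, by norm_num, max m₁ m₂, ?_⟩
  intro d m hd hm hdc _ F hF hdepth hsize
  -- the three regimes
  have hmono : ∀ c' : ℝ, min c₁ (min c₂ (1 / 64)) ≤ c' → (d : ℝ) ≤ c' * m / Real.logb 2 m := by
    intro c' hc'
    refine hdc.trans ?_
    rcases Nat.eq_zero_or_pos m with h0 | hpos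
    · subst h0; simp
    · have hlog : 0 ≤ Real.logb 2 (m : ℝ) := Real.logb_nonneg one_lt_two (by exact_mod_cast hpos)
      exact div_le_div_of_nonneg_right (mul_le_mul_of_nonneg_right hc' (Nat.cast_nonneg _)) hlog
  have hdc1 := hmono c₁ (min_le_left _ _)
  have hdc2 := hmono c₂ ((min_le_right _ _).trans (min_le_left _ _))
  obtain ⟨hm128, hdlog, hdm, hlog1⟩ := regime_basic ((min_le_right _ _).trans (min_le_right _ _)) hd hdc
  have hm2 : 2 ≤ m := le_trans (by norm_num) hm128
  have hm3 : 3 ≤ m := le_trans (by norm_num) hm128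
  have hS : Small m := hm₂ m (le_trans (le_max_right _ _) hm)
  have h71' := h71 m d hd hdc1
  have hw0' := hm₁ m (le_trans (le_max_left _ _) hm) d hd hdc2
  -- `w₀ ∈ [2^m/4, 1.1 · 2^m]`
  have hL1 := Real.log_two_gt_d9
  have hL2 := Real.log_two_lt_d9
  have h2m : (2 : ℝ) ^ (m : ℝ) = 2 ^ m := Real.rpow_natCast 2 m
  have hML : (0 : ℝ) < 2 ^ m * Real.log 2 := by positivity
  have hw0ab := abs_le.1 hw0'
  rw [div_sub_one hML.ne', div_le_iff₀ hML] at hw0ab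
  rw [le_div_iff₀ hML] at hw0ab
  have h2pos : (0 : ℝ) < 2 ^ m := pow_pos two_pos m
  have hlo' : (2 : ℝ) ^ m * 0.6931471803 ≤ 2 ^ m * Real.log 2 := mul_le_mul_of_nonneg_left hL1.le h2pos.le
  have hhi' : (2 : ℝ) ^ m * Real.log 2 ≤ 2 ^ m * 0.6931471808 := mul_le_mul_of_nonneg_left hL2.le h2pos.le
  have hw0lo : (2 : ℝ) ^ (m : ℝ) / 4 ≤ rstW0 m d := by rw [h2m]; linarith [hw0ab.1]
  have hw0hi : (rstW0 m d : ℝ) ≤ 1.1 * (2 : ℝ) ^ (m : ℝ) := by rw [h2m]; linarith [hw0ab.2]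
  have hw0w : rstW0 m d ≤ rstW m := by
    have := rstW_ge hm3
    have : (rstW0 m d : ℝ) ≤ rstW m := by linarith
    exact_mod_cast this
  -- the facts
  have H : RegimeFacts m d := regimeFacts_of hm128 hd hS h71'
  have T := typFacts_of hm128 hd hS hdlog hw0lo hw0hi
  obtain ⟨hb1, hb2, hε₀⟩ := bias_window hm128 hd hS (H.t_win 1 le_rfl (by omega))
  obtain ⟨_, _, hs1, _, _⟩ := s_bounds hm128 hS
  -- the chain, and the budget
  have main := agreement_le hd H T hs1 hε₀ hb1 hb2 F hF hdepth
  have hNpos : 0 < rstN m d := by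
    rw [rstN_eq]
    exact Nat.mul_pos (Nat.mul_pos T.w0_pos (pow_pos (lt_of_lt_of_le T.w0_pos T.w0_le) _)) T.m_pos
  have hbud := budget hm128 hd hS H hdm hw0w hNpos hsize
  refine main.trans (mul_le_mul_of_nonneg_right (by linarith) (by positivity))

end RSTProj

/-- **Rossman–Servedio–Tan 2015, Theorem 1 in the regime of Lemma 7.1** — discharge of the named
fact `rossmanServedioTan2015_thm1_inRegime` (constants `c = min(c_{7.1}, c_{w₀}, 1/64)`,
`C = 1/48`). The proof is the chain of sibling files `AverageCaseDepthHierarchy{PSL, BlockLaw,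
Level, Process, Chernoff, BlockProbs, Typical, TypicalRST, Collapse, Assembly, Params, Numeric,
Stages, TypNum, Final, AsymA}` formalising RST §7–§11: the projection switching lemma (Thm. 9),
the completion to uniform (Props. 1–2), typicality (§10.1), Prop. 14, the §11.2 assembly, and the
asymptotics of the parameters. [cite: RossmanServedioTan2015, Theorem 1 (p. 3); Lemma 7.1 (p. 16); §11.2 (pp. 37–38)] -/
theorem rossmanServedioTan2015_thm1_inRegime_holds : rossmanServedioTan2015_thm1_inRegime :=
  RSTProj.rst_thm1_inRegime_proof

end Literature.Computability.Complexity

end
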